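import Literature.AlgebraicGeometry.Motives.MixedHodgeExtensionYonedaExtTwo
import HarnessLib

/-!
# Yoneda's `Ext³ = 0` for mixed Hodge structures: three-fold extensions are congruent to zero

Mac Lane, *Homology* (1963), Ch. III §5: the `n`-fold extensions `0 → B → E₁ → ⋯ → Eₙ → A → 0`, their
congruence (generated by morphisms with identity ends, Prop. 5.2) and the zero `S₀` (Thm. 5.3); (5.1): the
Yoneda composite. Brylinski–Zucker, *An overview of recent advances in Hodge theory* (1990), Prop. 5.22,
Cor.: "`Ext^j_{A-MH}(E, F) = 0` for `j ≥ 2`". Carlson, *Extensions of mixed Hodge structures* (1980), §2.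

`Motives/MixedHodgeExtensionYonedaExtTwo` proved the case `j = 2`: every two-fold extension `E` of mixed
`ℚ`-Hodge structures admits morphisms `E → M ← S₀` with identity ends
(`TwoExtension.exists_morphism_trivial_morphism`). This file proves the case `j = 3` (whence, by the same
splicing, all `j ≥ 3` — `-- TODO(general form): n-fold extensions for every n ≥ 2, by induction on n`):

* §1 **the zero mixed Hodge structure** on a zero space (`MixedHodgeStructure.ofSubsingleton`; on `PUnit`:
  `zeroMHS`).
* §2 **three-fold extensions** `0 → B → E₁ → E₂ → E₃ → A → 0` (`ThreeExtension`), the zero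
  `S₀ = (0 → B = B → 0 → A = A → 0)` (`ThreeExtension.trivial`), the Yoneda composite `e ∘ E` of an
  extension `e : 0 → B → E₁ → K → 0` with a two-fold extension `E` of `A` by `K` (`Extension.spliceTwo`),
  morphisms of three-fold extensions (`ThreeExtension.Morphism`, `id`, `comp`).
* §3 **every three-fold extension is a Yoneda composite**: `E ≅ e₁ ∘ E₂` with `e₁ = (0 → B → E₁ → Ker d₂ → 0)`,
  `E₂ = (0 → Ker d₂ → E₂ → E₃ → A → 0)` (`factor₁`, `factor₂`, `morphismSplice` with identity components).
* §4 splicing is functorial in the two-fold extension (`Extension.spliceTwoMorphism`), and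
  `S₀ → e ∘ S₀(A, K)` (`ThreeExtension.trivialMorphismSplice`).
* §5 **`Ext³_MHS(A, B) = 0`**: every three-fold extension `E` of `A` by `B` is connected to `S₀` by morphisms
  with identity ends, `E → M ← N ← S₀` (`ThreeExtension.exists_zigzag_trivial`).

All statements proved; definitions with bodies; no named facts, no instances.

## References

* [MacLane1963Homology] S. Mac Lane, Homology (1963), Ch. III §5, (5.1), Prop. 5.2, Thm. 5.3 (held text
  `book:mac-lane1963-homology`, PDF pp. 104–109).
* [BrylinskiZucker1998] J.-L. Brylinski, S. Zucker, An overview of recent advances in Hodge theory (1990),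
  Prop. 5.22 and its Corollary.
* [Carlson1980] J. A. Carlson, Extensions of mixed Hodge structures (1980), §2.
-/

open scoped TensorProduct

noncomputable section

namespace Literature.AlgebraicGeometry.Motives

namespace MixedHodgeStructure

universe u

variable {VA : Type*} [AddCommGroup VA] [Module ℚ VA]
variable {VB : Type*} [AddCommGroup VB] [Module ℚ VB]
variable {V₁ : Type*} [AddCommGroup V₁] [Module ℚ V₁]
variable {V₂ : Type*} [AddCommGroup V₂] [Module ℚ V₂]
variable {V₃ : Type*} [AddCommGroup V₃] [Module ℚ V₃]
variable {VK : Type*} [AddCommGroup VK] [Module ℚ VK]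

/-! ### §1 The zero mixed Hodge structure -/

/-- The complexification of a zero space is zero. [cite: MacLane1963Homology, Ch. III Thm. 5.3] -/
theorem subsingleton_baseChange_of_subsingleton (M : Type*) [AddCommGroup M] [Module ℚ M] [Subsingleton M] :
    Subsingleton (ℂ ⊗[ℚ] M) := by
  refine subsingleton_of_forall_eq 0 fun x => ?_
  induction x using TensorProduct.induction_on with
  | zero => rfl
  | tmul a m => rw [Subsingleton.elim m 0, TensorProduct.tmul_zero]
  | add x y hx hy => rw [hx, hy, add_zero]

/-- **The zero mixed Hodge structure** on a zero `ℚ`-space (all filtration steps `0 = everything`; the zero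
object of the abelian category of MHS). [cite: MacLane1963Homology, Ch. III Thm. 5.3] -/
def ofSubsingleton (V : Type u) [AddCommGroup V] [Module ℚ V] [Subsingleton V] : MixedHodgeStructure V where
  W _ := ⊥
  monotone_W _ _ _ := le_rfl
  exists_W_eq_bot := ⟨0, rfl⟩
  exists_W_eq_top := ⟨0, by
    haveI := (Submodule.subsingleton_iff ℚ).2 ‹Subsingleton V›
    exact Subsingleton.elim _ _⟩
  F _ := ⊥
  antitone_F _ _ _ := le_rfl
  exists_F_eq_top := ⟨0, by
    haveI := subsingleton_baseChange_of_subsingleton V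
    haveI := (Submodule.subsingleton_iff ℂ).2 ‹Subsingleton (ℂ ⊗[ℚ] V)›
    exact Subsingleton.elim _ _⟩
  exists_F_eq_bot := ⟨0, rfl⟩
  isCompl_grF k p q _ := by
    haveI : Subsingleton (grW (fun _ : ℤ => (⊥ : Submodule ℚ V)) k) := (Submodule.mkQ_surjective _).subsingleton
    haveI := subsingleton_baseChange_of_subsingleton (grW (fun _ : ℤ => (⊥ : Submodule ℚ V)) k)
    haveI := (Submodule.subsingleton_iff ℂ).2 ‹Subsingleton (ℂ ⊗[ℚ] grW (fun _ : ℤ => (⊥ : Submodule ℚ V)) k)›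
    exact IsCompl.of_eq (Subsingleton.elim _ _) (Subsingleton.elim _ _)

/-- **The zero object `0`** of the category of mixed `ℚ`-Hodge structures, on `PUnit`.
[cite: MacLane1963Homology, Ch. III Thm. 5.3] -/
def zeroMHS : MixedHodgeStructure PUnit.{1} :=
  ofSubsingleton PUnit

/-- Every morphism into the zero object is the zero morphism. [cite: MacLane1963Homology, Ch. III Thm. 5.3] -/
theorem Hom.eq_zero_of_subsingleton_target {V : Type*} [AddCommGroup V] [Module ℚ V] {W : Type*} [AddCommGroup W]
    [Module ℚ W] [Subsingleton W] {H : MixedHodgeStructure V} {Z : MixedHodgeStructure W} (f : Hom H Z) :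
    f = Hom.zero H Z :=
  Hom.ext (LinearMap.ext fun _ => Subsingleton.elim _ _)

/-- Every morphism out of the zero object is the zero morphism. [cite: MacLane1963Homology, Ch. III Thm. 5.3] -/
theorem Hom.eq_zero_of_subsingleton_source {V : Type*} [AddCommGroup V] [Module ℚ V] {W : Type*} [AddCommGroup W]
    [Module ℚ W] [Subsingleton W] {Z : MixedHodgeStructure W} {H : MixedHodgeStructure V} (f : Hom Z H) :
    f = Hom.zero Z H :=
  Hom.ext (LinearMap.ext fun x => by rw [Subsingleton.elim x 0, map_zero, map_zero])

/-! ### §2 Three-fold extensions, the zero `S₀`, the Yoneda composite, morphisms -/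

/-- A **three-fold extension of `A` by `B`** in the category of mixed `ℚ`-Hodge structures: an exact sequence
`0 → B —inc→ E₁ —d₁→ E₂ —d₂→ E₃ —proj→ A → 0` of morphisms of mixed Hodge structures (Mac Lane, Ch. III §5;
the elements of Yoneda's `Ext³(A, B)` are the congruence classes of these). [cite: MacLane1963Homology, Ch. III §5 (5.1)] -/
structure ThreeExtension (A : MixedHodgeStructure VA) (B : MixedHodgeStructure VB) (V₁ : Type*) (V₂ : Type*)
    (V₃ : Type*) [AddCommGroup V₁] [Module ℚ V₁] [AddCommGroup V₂] [Module ℚ V₂] [AddCommGroup V₃] [Module ℚ V₃]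
    where
  /-- The mixed Hodge structure `E₁` next to the sub `B`. -/
  mhs₁ : MixedHodgeStructure V₁
  /-- The middle mixed Hodge structure `E₂`. -/
  mhs₂ : MixedHodgeStructure V₂
  /-- The mixed Hodge structure `E₃` next to the quotient `A`. -/
  mhs₃ : MixedHodgeStructure V₃
  /-- `B → E₁`. -/
  inc : Hom B mhs₁
  /-- `E₁ → E₂`. -/
  d₁ : Hom mhs₁ mhs₂
  /-- `E₂ → E₃`. -/
  d₂ : Hom mhs₂ mhs₃
  /-- `E₃ → A`. -/
  proj : Hom mhs₃ A
  /-- Exactness at `B`. -/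
  injective_inc : Function.Injective inc.toLinearMap
  /-- Exactness at `E₁`. -/
  exact_inc_d₁ : Function.Exact inc.toLinearMap d₁.toLinearMap
  /-- Exactness at `E₂`. -/
  exact_d₁_d₂ : Function.Exact d₁.toLinearMap d₂.toLinearMap
  /-- Exactness at `E₃`. -/
  exact_d₂_proj : Function.Exact d₂.toLinearMap proj.toLinearMap
  /-- Exactness at `A`. -/
  surjective_proj : Function.Surjective proj.toLinearMap

namespace ThreeExtension

variable {A : MixedHodgeStructure VA} {B : MixedHodgeStructure VB} {K : MixedHodgeStructure VK}

section Basic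

variable (E : ThreeExtension A B V₁ V₂ V₃)

/-- `d₂ ∘ d₁ = 0`. [cite: MacLane1963Homology, Ch. III §5 (5.1)] -/
theorem d₂_comp_d₁ : E.d₂.comp E.d₁ = Hom.zero E.mhs₁ E.mhs₃ :=
  Hom.ext (LinearMap.ext fun x => (E.exact_d₁_d₂ (E.d₁.toLinearMap x)).2 ⟨x, rfl⟩)

/-- `d₁ ∘ inc = 0`. [cite: MacLane1963Homology, Ch. III §5 (5.1)] -/
theorem d₁_comp_inc : E.d₁.comp E.inc = Hom.zero B E.mhs₂ :=
  Hom.ext (LinearMap.ext fun b => (E.exact_inc_d₁ (E.inc.toLinearMap b)).2 ⟨b, rfl⟩)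

/-- `proj ∘ d₂ = 0`. [cite: MacLane1963Homology, Ch. III §5 (5.1)] -/
theorem proj_comp_d₂ : E.proj.comp E.d₂ = Hom.zero E.mhs₂ A :=
  Hom.ext (LinearMap.ext fun y => (E.exact_d₂_proj (E.d₂.toLinearMap y)).2 ⟨y, rfl⟩)

end Basic

/-- **The zero three-fold extension `S₀ : 0 → B = B → 0 → A = A → 0`** (Mac Lane, Thm. 5.3, `n = 3`), with
the zero object `0` on `PUnit` in the middle. [cite: MacLane1963Homology, Ch. III Thm. 5.3] -/
def trivial (A : MixedHodgeStructure VA) (B : MixedHodgeStructure VB) : ThreeExtension A B VB PUnit.{1} VA where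
  mhs₁ := B
  mhs₂ := zeroMHS
  mhs₃ := A
  inc := Hom.id B
  d₁ := Hom.zero B zeroMHS
  d₂ := Hom.zero zeroMHS A
  proj := Hom.id A
  injective_inc := Function.injective_id
  exact_inc_d₁ := fun b => ⟨fun _ => ⟨b, rfl⟩, fun _ => Subsingleton.elim _ _⟩
  exact_d₁_d₂ := fun z => ⟨fun _ => ⟨0, Subsingleton.elim _ _⟩, fun _ => rfl⟩
  exact_d₂_proj := fun a => by
    constructor
    · intro ha
      exact ⟨0, (LinearMap.zero_apply _).trans (ha : a = 0).symm⟩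
    · rintro ⟨z, rfl⟩
      rfl
  surjective_proj := Function.surjective_id

end ThreeExtension

namespace Extension

variable {A : MixedHodgeStructure VA} {B : MixedHodgeStructure VB} {K : MixedHodgeStructure VK}

/-- **The Yoneda composite `e ∘ E : 0 → B → E₁ → E₂ → E₃ → A → 0`** of an extension
`e : 0 → B → E₁ → K → 0` with a two-fold extension `E : 0 → K → E₂ → E₃ → A → 0`, spliced through
`E₁ → K → E₂`. [cite: MacLane1963Homology, Ch. III §5 (5.1)] -/
def spliceTwo (e : Extension K B V₁) (E : TwoExtension A K V₂ V₃) : ThreeExtension A B V₁ V₂ V₃ where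
  mhs₁ := e.mhs
  mhs₂ := E.mhs₁
  mhs₃ := E.mhs₂
  inc := e.inc
  d₁ := E.inc.comp e.proj
  d₂ := E.mid
  proj := E.proj
  injective_inc := e.injective_inc
  exact_inc_d₁ := by
    rw [LinearMap.exact_iff, Hom.comp_toLinearMap,
      LinearMap.ker_comp_of_ker_eq_bot _ (LinearMap.ker_eq_bot.2 E.injective_inc)]
    exact e.exact.linearMap_ker_eq
  exact_d₁_d₂ := by
    rw [LinearMap.exact_iff, Hom.comp_toLinearMap,
      LinearMap.range_comp_of_range_eq_top _ (LinearMap.range_eq_top.2 e.surjective_proj)]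
    exact E.exact_inc_mid.linearMap_ker_eq
  exact_d₂_proj := E.exact_mid_proj
  surjective_proj := E.surjective_proj

/-- The data of the Yoneda composite (by `rfl`). [cite: MacLane1963Homology, Ch. III §5 (5.1)] -/
@[simp] theorem spliceTwo_d₁ (e : Extension K B V₁) (E : TwoExtension A K V₂ V₃) :
    (spliceTwo e E).d₁ = E.inc.comp e.proj := rfl

/-- The data of the Yoneda composite (by `rfl`). [cite: MacLane1963Homology, Ch. III §5 (5.1)] -/
@[simp] theorem spliceTwo_d₂ (e : Extension K B V₁) (E : TwoExtension A K V₂ V₃) : (spliceTwo e E).d₂ = E.mid := rfl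

/-- The data of the Yoneda composite (by `rfl`). [cite: MacLane1963Homology, Ch. III §5 (5.1)] -/
@[simp] theorem spliceTwo_inc (e : Extension K B V₁) (E : TwoExtension A K V₂ V₃) : (spliceTwo e E).inc = e.inc := rfl

/-- The data of the Yoneda composite (by `rfl`). [cite: MacLane1963Homology, Ch. III §5 (5.1)] -/
@[simp] theorem spliceTwo_proj (e : Extension K B V₁) (E : TwoExtension A K V₂ V₃) : (spliceTwo e E).proj = E.proj := rfl

end Extension

namespace ThreeExtension

variable {A : MixedHodgeStructure VA} {B : MixedHodgeStructure VB} {K : MixedHodgeStructure VK}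

section Morphism

variable {VA' : Type*} [AddCommGroup VA'] [Module ℚ VA']
variable {VB' : Type*} [AddCommGroup VB'] [Module ℚ VB']
variable {V₁' : Type*} [AddCommGroup V₁'] [Module ℚ V₁']
variable {V₂' : Type*} [AddCommGroup V₂'] [Module ℚ V₂']
variable {V₃' : Type*} [AddCommGroup V₃'] [Module ℚ V₃']
variable {VA'' : Type*} [AddCommGroup VA''] [Module ℚ VA'']
variable {VB'' : Type*} [AddCommGroup VB''] [Module ℚ VB'']
variable {V₁'' : Type*} [AddCommGroup V₁''] [Module ℚ V₁'']
variable {V₂'' : Type*} [AddCommGroup V₂''] [Module ℚ V₂'']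
variable {V₃'' : Type*} [AddCommGroup V₃''] [Module ℚ V₃'']
variable {A' : MixedHodgeStructure VA'} {B' : MixedHodgeStructure VB'}
variable {A'' : MixedHodgeStructure VA''} {B'' : MixedHodgeStructure VB''}

/-- A **morphism of three-fold extensions**: morphisms of MHS on all five terms commuting with the four
structure maps (Mac Lane, Ch. III §5: the morphisms generating the congruence of `n`-fold exact sequences).
[cite: MacLane1963Homology, Ch. III §5 Prop. 5.2] -/
structure Morphism (E : ThreeExtension A B V₁ V₂ V₃) (E' : ThreeExtension A' B' V₁' V₂' V₃') where
  /-- The component on the subs `B → B'`. -/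
  left : Hom B B'
  /-- The component `E₁ → E₁'`. -/
  one : Hom E.mhs₁ E'.mhs₁
  /-- The component `E₂ → E₂'`. -/
  two : Hom E.mhs₂ E'.mhs₂
  /-- The component `E₃ → E₃'`. -/
  three : Hom E.mhs₃ E'.mhs₃
  /-- The component on the quotients `A → A'`. -/
  right : Hom A A'
  /-- The square at `B`. -/
  one_inc : one.toLinearMap ∘ₗ E.inc.toLinearMap = E'.inc.toLinearMap ∘ₗ left.toLinearMap
  /-- The square at `E₁`. -/
  d₁_one : E'.d₁.toLinearMap ∘ₗ one.toLinearMap = two.toLinearMap ∘ₗ E.d₁.toLinearMap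
  /-- The square at `E₂`. -/
  d₂_two : E'.d₂.toLinearMap ∘ₗ two.toLinearMap = three.toLinearMap ∘ₗ E.d₂.toLinearMap
  /-- The square at `E₃`. -/
  proj_three : E'.proj.toLinearMap ∘ₗ three.toLinearMap = right.toLinearMap ∘ₗ E.proj.toLinearMap

namespace Morphism

variable {E : ThreeExtension A B V₁ V₂ V₃} {E' : ThreeExtension A' B' V₁' V₂' V₃'}
  {E'' : ThreeExtension A'' B'' V₁'' V₂'' V₃''}

/-- The identity morphism. [cite: MacLane1963Homology, Ch. III §5 Prop. 5.2] -/
protected def id (E : ThreeExtension A B V₁ V₂ V₃) : Morphism E E where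
  left := Hom.id B
  one := Hom.id E.mhs₁
  two := Hom.id E.mhs₂
  three := Hom.id E.mhs₃
  right := Hom.id A
  one_inc := by simp
  d₁_one := by simp
  d₂_two := by simp
  proj_three := by simp

/-- Composition of morphisms of three-fold extensions. [cite: MacLane1963Homology, Ch. III §5 Prop. 5.2] -/
def comp (m' : Morphism E' E'') (m : Morphism E E') : Morphism E E'' where
  left := m'.left.comp m.left
  one := m'.one.comp m.one
  two := m'.two.comp m.two
  three := m'.three.comp m.three
  right := m'.right.comp m.right
  one_inc := by
    rw [Hom.comp_toLinearMap, Hom.comp_toLinearMap, LinearMap.comp_assoc, m.one_inc, ← LinearMap.comp_assoc,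
      m'.one_inc, LinearMap.comp_assoc]
  d₁_one := by
    rw [Hom.comp_toLinearMap, Hom.comp_toLinearMap, ← LinearMap.comp_assoc, m'.d₁_one, LinearMap.comp_assoc,
      m.d₁_one, ← LinearMap.comp_assoc]
  d₂_two := by
    rw [Hom.comp_toLinearMap, Hom.comp_toLinearMap, ← LinearMap.comp_assoc, m'.d₂_two, LinearMap.comp_assoc,
      m.d₂_two, ← LinearMap.comp_assoc]
  proj_three := by
    rw [Hom.comp_toLinearMap, Hom.comp_toLinearMap, ← LinearMap.comp_assoc, m'.proj_three, LinearMap.comp_assoc,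
      m.proj_three, ← LinearMap.comp_assoc]

/-- Ends of a composite. [cite: MacLane1963Homology, Ch. III §5 Prop. 5.2] -/
@[simp] theorem comp_left (m' : Morphism E' E'') (m : Morphism E E') : (m'.comp m).left = m'.left.comp m.left := rfl

/-- Ends of a composite. [cite: MacLane1963Homology, Ch. III §5 Prop. 5.2] -/
@[simp] theorem comp_right (m' : Morphism E' E'') (m : Morphism E E') : (m'.comp m).right = m'.right.comp m.right := rfl

end Morphism

end Morphism

/-! ### §3 Every three-fold extension is a Yoneda composite `e₁ ∘ E₂` -/

section Factor

variable (E : ThreeExtension A B V₁ V₂ V₃)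

/-- The sub-MHS `K = Ker d₂ = Im d₁ ⊆ E₂` through which `E` factors. [cite: MacLane1963Homology, Ch. III §5 (5.1)] -/
def kerSub : SubMixedHodgeStructure E.mhs₂ :=
  E.d₂.ker

/-- `E₁ → Ker d₂`, the co-restriction of `d₁`. [cite: MacLane1963Homology, Ch. III §5 (5.1)] -/
def toKer : Hom E.mhs₁ E.kerSub.toMixedHodgeStructure :=
  E.d₂.kerLift E.d₁ E.d₂_comp_d₁

/-- `(Ker d₂ ↪ E₂) ∘ toKer = d₁`. [cite: MacLane1963Homology, Ch. III §5 (5.1)] -/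
theorem kerSub_subtype_comp_toKer : E.kerSub.subtype.comp E.toKer = E.d₁ :=
  E.d₂.ker_subtype_comp_kerLift E.d₁ E.d₂_comp_d₁

/-- `E₁ → Ker d₂` is surjective (`Im d₁ = Ker d₂`). [cite: MacLane1963Homology, Ch. III §5 (5.1)] -/
theorem toKer_surjective : Function.Surjective E.toKer.toLinearMap := by
  intro z
  obtain ⟨x, hx⟩ := (E.exact_d₁_d₂ (z : V₂)).1 z.2
  exact ⟨x, Subtype.ext hx⟩

/-- `0 → B → E₁ → Ker d₂ → 0` is exact at `E₁`. [cite: MacLane1963Homology, Ch. III §5 (5.1)] -/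
theorem exact_inc_toKer : Function.Exact E.inc.toLinearMap E.toKer.toLinearMap := by
  intro x
  rw [← E.exact_inc_d₁ x]
  constructor
  · intro h
    have h' := congrArg Subtype.val h
    exact h'
  · intro h
    exact Subtype.ext h

/-- **The first factor `e₁ = (0 → B → E₁ → Ker d₂ → 0)`** of `E`. [cite: MacLane1963Homology, Ch. III §5 (5.1)] -/
def factor₁ : Extension E.kerSub.toMixedHodgeStructure B V₁ :=
  Extension.ofExact E.mhs₁ E.inc E.toKer E.injective_inc E.toKer_surjective E.exact_inc_toKer

/-- **The second factor `E₂ = (0 → Ker d₂ → E₂ → E₃ → A → 0)`** of `E`, a two-fold extension of `A` by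
`Ker d₂`. [cite: MacLane1963Homology, Ch. III §5 (5.1)] -/
def factor₂ : TwoExtension A E.kerSub.toMixedHodgeStructure V₂ V₃ where
  mhs₁ := E.mhs₂
  mhs₂ := E.mhs₃
  inc := E.kerSub.subtype
  mid := E.d₂
  proj := E.proj
  injective_inc := E.d₂.ker_subtype_injective
  exact_inc_mid := E.d₂.exact_ker_subtype
  exact_mid_proj := E.exact_d₂_proj
  surjective_proj := E.surjective_proj

/-- **`E → e₁ ∘ E₂` with identity components**: every three-fold extension "is" the Yoneda composite of its
two factors. [cite: MacLane1963Homology, Ch. III §5 (5.1)] -/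
def morphismSplice : Morphism E (E.factor₁.spliceTwo E.factor₂) where
  left := Hom.id B
  one := Hom.id E.mhs₁
  two := Hom.id E.mhs₂
  three := Hom.id E.mhs₃
  right := Hom.id A
  one_inc := by rw [Hom.id_toLinearMap, Hom.id_toLinearMap, LinearMap.id_comp, LinearMap.comp_id]; rfl
  d₁_one := by
    rw [Hom.id_toLinearMap, Hom.id_toLinearMap, LinearMap.id_comp, LinearMap.comp_id, Extension.spliceTwo_d₁]
    exact congrArg Hom.toLinearMap E.kerSub_subtype_comp_toKer
  d₂_two := by rw [Hom.id_toLinearMap, Hom.id_toLinearMap, LinearMap.id_comp, LinearMap.comp_id]; rfl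
  proj_three := by rw [Hom.id_toLinearMap, Hom.id_toLinearMap, LinearMap.id_comp, LinearMap.comp_id]; rfl

/-- The ends of `morphismSplice` are identities (by `rfl`). [cite: MacLane1963Homology, Ch. III §5 (5.1)] -/
@[simp] theorem morphismSplice_left : E.morphismSplice.left = Hom.id B := rfl

/-- The ends of `morphismSplice` are identities (by `rfl`). [cite: MacLane1963Homology, Ch. III §5 (5.1)] -/
@[simp] theorem morphismSplice_right : E.morphismSplice.right = Hom.id A := rfl

end Factor

end ThreeExtension

/-! ### §4 Functoriality of splicing; `S₀ → e ∘ S₀(A, K)` -/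

namespace Extension

variable {A : MixedHodgeStructure VA} {B : MixedHodgeStructure VB} {K : MixedHodgeStructure VK}
variable {V₂' : Type*} [AddCommGroup V₂'] [Module ℚ V₂']
variable {V₃' : Type*} [AddCommGroup V₃'] [Module ℚ V₃']

/-- **Splicing is functorial in the two-fold extension**: a morphism `E → E'` of two-fold extensions of `A`
by `K` which is the identity on `K` induces `e ∘ E → e ∘ E'` with components `(1_B, 1_{E₁}, m₁, m₂, m_A)`.
[cite: MacLane1963Homology, Ch. III §5 Prop. 5.2] -/
def spliceTwoMorphism (e : Extension K B V₁) {E : TwoExtension A K V₂ V₃} {E' : TwoExtension A K V₂' V₃'}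
    (m : TwoExtension.Morphism E E') (hm : m.left = Hom.id K) :
    ThreeExtension.Morphism (e.spliceTwo E) (e.spliceTwo E') where
  left := Hom.id B
  one := Hom.id e.mhs
  two := m.one
  three := m.two
  right := m.right
  one_inc := by rw [Hom.id_toLinearMap, Hom.id_toLinearMap, LinearMap.id_comp, LinearMap.comp_id]; rfl
  d₁_one := by
    rw [Hom.id_toLinearMap, LinearMap.comp_id, spliceTwo_d₁, spliceTwo_d₁, Hom.comp_toLinearMap,
      Hom.comp_toLinearMap, ← LinearMap.comp_assoc, m.one_inc, hm, Hom.id_toLinearMap, LinearMap.comp_id]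
  d₂_two := by rw [spliceTwo_d₂, spliceTwo_d₂]; exact m.mid_one
  proj_three := by rw [spliceTwo_proj, spliceTwo_proj]; exact m.proj_two

/-- Ends of `spliceTwoMorphism` (by `rfl`). [cite: MacLane1963Homology, Ch. III §5 Prop. 5.2] -/
@[simp] theorem spliceTwoMorphism_left (e : Extension K B V₁) {E : TwoExtension A K V₂ V₃}
    {E' : TwoExtension A K V₂' V₃'} (m : TwoExtension.Morphism E E') (hm : m.left = Hom.id K) :
    (e.spliceTwoMorphism m hm).left = Hom.id B := rfl

/-- Ends of `spliceTwoMorphism` (by `rfl`). [cite: MacLane1963Homology, Ch. III §5 Prop. 5.2] -/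
@[simp] theorem spliceTwoMorphism_right (e : Extension K B V₁) {E : TwoExtension A K V₂ V₃}
    {E' : TwoExtension A K V₂' V₃'} (m : TwoExtension.Morphism E E') (hm : m.left = Hom.id K) :
    (e.spliceTwoMorphism m hm).right = m.right := rfl

end Extension

namespace ThreeExtension

variable {A : MixedHodgeStructure VA} {B : MixedHodgeStructure VB} {K : MixedHodgeStructure VK}

/-- **`S₀(A, B) → e ∘ S₀(A, K)`**: the morphism `(1_B, inc_e, 0, 1_A, 1_A)` from the zero three-fold extension
to the splice of `e : 0 → B → E₁ → K → 0` with the zero two-fold extension `S₀(A, K) = (K = K —0→ A = A)` (the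
square at `E₁` commutes because `proj_e ∘ inc_e = 0`). [cite: MacLane1963Homology, Ch. III Thm. 5.3] -/
def trivialMorphismSplice (e : Extension K B V₁) : Morphism (trivial A B) (e.spliceTwo (TwoExtension.trivial A K)) where
  left := Hom.id B
  one := e.inc
  two := Hom.zero zeroMHS K
  three := Hom.id A
  right := Hom.id A
  one_inc := by rw [Hom.id_toLinearMap, LinearMap.comp_id]; rfl
  d₁_one := by
    refine LinearMap.ext fun b => ?_
    rw [Extension.spliceTwo_d₁, LinearMap.comp_apply, Hom.comp_toLinearMap, LinearMap.comp_apply,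
      TwoExtension.trivial_inc, Hom.id_toLinearMap, LinearMap.id_apply, e.proj_inc, LinearMap.comp_apply]
    exact (map_zero _).symm
  d₂_two := LinearMap.ext fun z => by
    rw [LinearMap.comp_apply, LinearMap.comp_apply, Extension.spliceTwo_d₂, TwoExtension.trivial_mid]
    change (0 : VA) = (Hom.id A).toLinearMap ((Hom.zero zeroMHS A).toLinearMap z)
    rfl
  proj_three := by rw [Extension.spliceTwo_proj, TwoExtension.trivial_proj]; rfl

/-- Ends of `trivialMorphismSplice` (by `rfl`). [cite: MacLane1963Homology, Ch. III Thm. 5.3] -/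
@[simp] theorem trivialMorphismSplice_left (e : Extension K B V₁) :
    (trivialMorphismSplice (A := A) e).left = Hom.id B := rfl

/-- Ends of `trivialMorphismSplice` (by `rfl`). [cite: MacLane1963Homology, Ch. III Thm. 5.3] -/
@[simp] theorem trivialMorphismSplice_right (e : Extension K B V₁) :
    (trivialMorphismSplice (A := A) e).right = Hom.id A := rfl

/-! ### §5 `Ext³_MHS = 0` -/

/-- **Yoneda's `Ext³_MHS(A, B) = 0`: every three-fold extension `E` of mixed `ℚ`-Hodge structures is
congruent to the zero `S₀`**, through the zigzag of morphisms with identity ends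
`E → e₁ ∘ M ← e₁ ∘ S₀(A, K) ← S₀(A, B)`, where `E ≅ e₁ ∘ E₂` (§3), `E₂ → M ← S₀(A, K)` is the zigzag of
`Ext² = 0` (`TwoExtension.exists_morphism_trivial_morphism`) and the last arrow is `trivialMorphismSplice`
(Brylinski–Zucker: `Ext^j = 0` for `j ≥ 2`). [cite: BrylinskiZucker1998, Prop. 5.22 Cor.]
[cite: MacLane1963Homology, Ch. III §5 Prop. 5.2 and Thm. 5.3] -/
theorem exists_zigzag_trivial (E : ThreeExtension A B V₁ V₂ V₃) :
    ∃ (M : ThreeExtension A B V₁ (V₃ × ↥E.kerSub.toSubmodule) (V₃ × VA))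
      (N : ThreeExtension A B V₁ ↥E.kerSub.toSubmodule VA),
      (∃ m : Morphism E M, m.left = Hom.id B ∧ m.right = Hom.id A) ∧
        (∃ m : Morphism N M, m.left = Hom.id B ∧ m.right = Hom.id A) ∧
          ∃ m : Morphism (trivial A B) N, m.left = Hom.id B ∧ m.right = Hom.id A := by
  obtain ⟨M₂, ⟨m, hml, hmr⟩, ⟨m₀, hm₀l, hm₀r⟩⟩ := E.factor₂.exists_morphism_trivial_morphism
  refine ⟨E.factor₁.spliceTwo M₂, E.factor₁.spliceTwo (TwoExtension.trivial A E.kerSub.toMixedHodgeStructure),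
    ⟨(E.factor₁.spliceTwoMorphism m hml).comp E.morphismSplice, ?_, ?_⟩,
    ⟨E.factor₁.spliceTwoMorphism m₀ hm₀l, rfl, hm₀r⟩, ⟨trivialMorphismSplice E.factor₁, rfl, rfl⟩⟩
  · rw [Morphism.comp_left, Extension.spliceTwoMorphism_left, morphismSplice_left]
    rfl
  · rw [Morphism.comp_right, Extension.spliceTwoMorphism_right, morphismSplice_right, hmr]
    rfl

/-- The same for a Yoneda composite `e ∘ E` of an extension with a two-fold extension: congruent to `S₀`.
[cite: BrylinskiZucker1998, Prop. 5.22 Cor.] -/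
theorem spliceTwo_exists_zigzag_trivial (e : Extension K B V₁) (E₂ : TwoExtension A K V₂ V₃) :
    ∃ (M : ThreeExtension A B V₁ (V₃ × ↥(e.spliceTwo E₂).kerSub.toSubmodule) (V₃ × VA))
      (N : ThreeExtension A B V₁ ↥(e.spliceTwo E₂).kerSub.toSubmodule VA),
      (∃ m : Morphism (e.spliceTwo E₂) M, m.left = Hom.id B ∧ m.right = Hom.id A) ∧
        (∃ m : Morphism N M, m.left = Hom.id B ∧ m.right = Hom.id A) ∧
          ∃ m : Morphism (trivial A B) N, m.left = Hom.id B ∧ m.right = Hom.id A :=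
  (e.spliceTwo E₂).exists_zigzag_trivial

end ThreeExtension

end MixedHodgeStructure

end Literature.AlgebraicGeometry.Motives
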